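import Summits.ResolutionOfSingularities.ResolutionOfSingularities.Theorems.CurveBranchRoot
import Summits.ResolutionOfSingularities.ResolutionOfSingularities.Theorems.CurveChainCutKernels3
import Literature.AlgebraicGeometry.Resolution.BlowupOffCentre
import Literature.AlgebraicGeometry.Resolution.MonomialOrderReductionUnit
import HarnessLib

/-!
# BranchStrictTransform — decomp-res lens-4 g45 node «BranchResolution», FILE A (§162–§163)

STAGE 2 of door (R3-C) (critic ROW 244 / letters 236b–236c): the stalk-level bridges between lens-6's hugging currency
(`strictTransformIdeal`, `SatelliteExitClasses.strictIter`) and the prime-chain currency of the landed g37 δ-engine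
`curveChain_stage_step` (Theorems/CurveChainCutKernels2).

* §162 (E1, POINT ROUND) `isPrime_stalkIdeal_strictTransformIdeal_point`: if `π` is the blowing up of a centre `Z` whose stalk at
  `π x'` is the maximal ideal, `𝔮 = 𝒦_{π x'}` is a prime `≠ 𝔪` and `x'` lies ON the strict transform of `𝒦`, then the followed
  stalk `𝒦'_{x'}` is PRIME and contracts to `𝔮` — in the Rees chart of the stalk (`IsBlowup.exists_reesChart_stalk`) it is the
  g44 operator `stOp σ (σ c_j) 𝔮`, identified with the kernel of Kollár's branch map `ψ_𝔮` (`isPrime_stOp_chart`, ring level).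
  The hypothesis `x' ∈ supp 𝒦'` is load-bearing (off the strict transform the stalk is `⊤`, not prime).
* §163 (E2, FOREIGN ROUND) `isPrime_stalkIdeal_strictTransformIdeal_foreign`: off the centre the stalk map is an isomorphism
  (`IsBlowup.isIso_stalkMap_of_not_mem_support`) carrying `𝒦_{π x'}` onto `𝒦'_{x'}`
  (`IsBlowup.stalkIdeal_strictTransformIdeal_of_not_mem`): prime, contracting to `𝔮`, with `𝒪/𝔮 ≃+* 𝒪'/𝔮'`.

No `def`, no named fact, no port, no sorry; engine and Literature lemmas BY NAME.  [cite: Kollar2007, §1.4, Thm. 1.101]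
[cite: Hironaka1964, Ch. 0 §2 p. 140; Ch. III §3 Lemma 6 p. 238]
-/

noncomputable section

set_option linter.dupNamespace false

open CategoryTheory CategoryTheory.Limits AlgebraicGeometry TopologicalSpace IsLocalRing
open Literature.AlgebraicGeometry.Resolution Scheme.IdealSheafData
open Summit.ResolutionOfSingularities.ResolutionOfSingularities.Theorems
open WeakOrderReduction ForcedTowerClasses DivergentTowerClasses MonomialTowerClasses
open HugDimensionClasses HugDimensionKernels SurfaceShadowClasses SurfaceShadowKernels AbsoluteContactClasses

namespace Summit.ResolutionOfSingularities.ResolutionOfSingularities.Theorems.HugValuationCut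

universe u

variable {k : Type} [Field k]

/-! ## §162 (g45 · E1, POINT ROUND) the followed strict-transform stalk of a PRIME germ `𝔮 ≠ 𝔪` through the blow-up of a point ON the germ
is the branch prime `ker ψ_𝔮` of Kollár's local quadratic transform: PRIME, contracting to `𝔮`.  (Bridge between lens-6's hugging currency
`strictIter` / `strictTransformIdeal` and the (CF∞) prime-chain currency of g37.) -/

section ChartRing

/-- **The ring-level heart of the point round** (the `g37` branch-map kernel `eq_ker_chartBranchMap`, read in a
local ring `S = B_𝔴` of the Rees chart `B = R[𝔪/c_j]`).  For a prime `q ∌ c_j` of `R` and the structure map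
`σ = (B → S) ∘ φ : R → S`, the strict-transform operator `stOp σ (σ(c_j)) q = ⋃ₙ (q S : σ(c_j)ⁿ)` — if proper — is
the kernel of the branch map `ψ_q : S → Frac(R/q)`; hence it is prime and contracts to `q`.
[cite: Hironaka1964, Ch. III §3 Lemma 6 p. 238] -/
theorem isPrime_stOp_chart {R S : Type u} [CommRing R] [CommRing S] [IsLocalRing S] {n : ℕ} (c : Fin n → R)
    (j : Fin n) (𝔴 : Ideal (chartRing c j)) [𝔴.IsPrime] [Algebra (chartRing c j) S]
    [IsLocalization.AtPrime S 𝔴] (q : Ideal R) [q.IsPrime] (hq : c j ∉ q) (σ : R →+* S)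
    (hσ : ∀ a, σ a = (algebraMap (chartRing c j) S : chartRing c j →+* S) (chartBase c j a)) (e₀ : S)
    (he₀ : e₀ = σ (c j))
    (hne : stOp σ (Ideal.span {e₀}) q ≠ ⊤) :
    (stOp σ (Ideal.span {e₀}) q).IsPrime ∧ (stOp σ (Ideal.span {e₀}) q).comap σ = q := by
  have hle : stOp σ (Ideal.span {e₀}) q ≤ maximalIdeal S := IsLocalRing.le_maximalIdeal hne
  have hmem : ∀ y, y ∈ stOp σ (Ideal.span {e₀}) q ↔ ∃ e : ℕ, y * e₀ ^ e ∈ q.map σ := by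
    intro y
    rw [mem_stOp_iff]
    simp only [Ideal.span_singleton_pow, Ideal.span_singleton_mul_span_singleton,
      Ideal.span_singleton_le_iff_mem]
  -- KEY (`g37`): `θ_q(b) = 0 ⟹ b/1 ∈ stOp`, from `φ(c_j)^e · b = φ(r)`
  have key : ∀ b, chartBranchMap c j q hq b = 0 →
      (algebraMap (chartRing c j) S : chartRing c j →+* S) b ∈ stOp σ (Ideal.span {e₀}) q := by
    intro b hb
    obtain ⟨e, r, her⟩ := exists_pow_mul_eq_reesChartBase c j b
    have hr : r ∈ q := by
      have h0 := congrArg (chartBranchMap c j q hq) her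
      simp only [map_mul, hb, mul_zero] at h0
      rw [chartToField_reesChartBase] at h0
      exact (branchPoint_eq_zero_iff q r).mp h0.symm
    rw [hmem]
    refine ⟨e, ?_⟩
    have h2 : σ (c j) ^ e * (algebraMap (chartRing c j) S : chartRing c j →+* S) b = σ r := by
      rw [hσ (c j), hσ r, ← her, map_mul,
        map_pow (algebraMap (chartRing c j) S : chartRing c j →+* S) (chartBase c j (c j)) e]
    rw [he₀, mul_comm, h2]
    exact Ideal.mem_map_of_mem σ hr
  -- the pass condition `ker θ_q ≤ 𝔴`
  have hpass : RingHom.ker (chartBranchMap c j q hq) ≤ 𝔴 := by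
    intro b hb
    have h1 := hle (key b hb)
    rwa [← Ideal.mem_comap, ← Ideal.under_def, IsLocalization.AtPrime.under_maximalIdeal S 𝔴] at h1
  -- the branch map `ψ_q : S → Frac(R/q)`, `ψ ∘ σ = branchPoint q`
  have hψσ : ∀ a, branchMap c j q hq 𝔴 S hpass (σ a) = branchPoint q a := by
    intro a
    rw [hσ]
    exact branchMap_algebraMap_reesChartBase S hpass a
  have hψe : branchMap c j q hq 𝔴 S hpass e₀ ≠ 0 := by
    rw [he₀, hψσ]
    exact (branchPoint_ne_zero_iff q _).mpr hq
  have hmaple : q.map σ ≤ RingHom.ker (branchMap c j q hq 𝔴 S hpass) := by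
    rw [Ideal.map_le_iff_le_comap]
    intro a ha
    rw [Ideal.mem_comap, RingHom.mem_ker, hψσ]
    exact (branchPoint_eq_zero_iff q a).mpr ha
  -- `stOp = ker ψ_q`
  have hker : stOp σ (Ideal.span {e₀}) q = RingHom.ker (branchMap c j q hq 𝔴 S hpass) := by
    apply le_antisymm
    · intro y hy
      obtain ⟨e, he⟩ := (hmem y).mp hy
      have h0 := hmaple he
      simp only [RingHom.mem_ker, map_mul, map_pow] at h0
      exact RingHom.mem_ker.mpr ((mul_eq_zero.mp h0).resolve_right (pow_ne_zero _ hψe))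
    · intro y hy
      obtain ⟨⟨b, s⟩, hbs⟩ := IsLocalization.surj 𝔴.primeCompl y
      have hb : chartBranchMap c j q hq b = 0 :=
        calc chartBranchMap c j q hq b
            = branchMap c j q hq 𝔴 S hpass ((algebraMap (chartRing c j) S : chartRing c j →+* S) b) :=
              (branchMap_algebraMap S hpass b).symm
          _ = branchMap c j q hq 𝔴 S hpass
                (y * (algebraMap (chartRing c j) S : chartRing c j →+* S) s) := by rw [hbs]
          _ = 0 := by rw [map_mul, RingHom.mem_ker.mp hy, zero_mul]
      obtain ⟨v, hv⟩ := IsLocalization.map_units S s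
      have hy' : y = (algebraMap (chartRing c j) S : chartRing c j →+* S) b * ↑v⁻¹ := by
        rw [← hbs, ← hv, mul_assoc, Units.mul_inv, mul_one]
      rw [hy']
      exact Ideal.mul_mem_right _ _ (key b hb)
  refine ⟨by rw [hker]; exact RingHom.ker_isPrime _, ?_⟩
  ext a
  rw [Ideal.mem_comap, hker, RingHom.mem_ker, hψσ, branchPoint_eq_zero_iff]

end ChartRing

section PointRound

variable {X X' : Scheme.{0}} [IsLocallyNoetherian X] [IsLocallyNoetherian X'] (π : X' ⟶ X)
  (Z 𝒦 : X.IdealSheafData)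

omit [IsLocallyNoetherian X] in
/-- the strict-transform stalk in ring-level form: `𝒦'_{x'} = stOp σ E_{x'} 𝒦_{π x'}` (`σ = π^#_{x'}`, `E = Z·𝒪_{X'}`).
[cite: Hironaka1964, Ch. 0 §2 p. 140] -/
theorem stalkIdeal_strictTransformIdeal_eq_stOp (x' : X') :
    stalkIdeal (strictTransformIdeal π Z 𝒦) x' =
      stOp (π.stalkMap x').hom (stalkIdeal (Z.comap π) x') (stalkIdeal 𝒦 (π x')) := by
  rw [stalkIdeal_strictTransformIdeal]; rfl

/-- a prime `𝔮` of a local ring with `dim A/𝔮 = 1` is not the maximal ideal. [folklore] -/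
theorem ne_maximalIdeal_of_ringKrullDim_quotient_eq_one {A : Type*} [CommRing A] [IsLocalRing A] {𝔮 : Ideal A}
    (hd : ringKrullDim (A ⧸ 𝔮) = 1) : 𝔮 ≠ maximalIdeal A := by
  rintro rfl
  rw [ringKrullDim_eq_zero_of_isField
    ((Ideal.Quotient.maximal_ideal_iff_isField_quotient (maximalIdeal A)).mp inferInstance)] at hd
  exact zero_ne_one hd

/-- **(E1) Point round.**  Let `π : X' → X` be the blowing up of `Z` with `Z_{π x'} = 𝔪_{π x'}` (the centre is
the reduced point `π x'` near `x'`), and let the stalk `𝔮 = 𝒦_{π x'}` be a prime with `dim 𝒪/𝔮 = 1`-type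
properness `𝔮 ≠ 𝔪`.  If `x'` lies on the strict transform `𝒦'`, then the stalk `𝔮' = 𝒦'_{x'}` is PRIME and
contracts to `𝔮` along `σ = π^#_{x'}`.  Proof: in the Rees chart `𝒪_{X',x'} = R[𝔪/c_j]_𝔴`
(`exists_reesChart_stalk`) the exceptional stalk is `(σ c_j)` and `𝔮' = stOp σ (σ c_j) 𝔮 = ker ψ_𝔮`
(`isPrime_stOp_chart`). [cite: Hironaka1964, Ch. III §3 Lemma 6 p. 238] -/
theorem isPrime_stalkIdeal_strictTransformIdeal_point (hπ : IsBlowup π Z) (x' : X')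
    (hZ : stalkIdeal Z (π x') = maximalIdeal _)
    [h𝔮 : (stalkIdeal 𝒦 (π x')).IsPrime] (hx' : x' ∈ ((strictTransformIdeal π Z 𝒦).support : Set X')) :
    (stalkIdeal (strictTransformIdeal π Z 𝒦) x').IsPrime ∧
      (stalkIdeal (strictTransformIdeal π Z 𝒦) x').comap (π.stalkMap x').hom = stalkIdeal 𝒦 (π x') := by
  have h𝔮'le : stalkIdeal (strictTransformIdeal π Z 𝒦) x' ≤ maximalIdeal _ :=
    (mem_support_iff_stalkIdeal_le _ _).mp hx'
  -- generators of `𝔪_{π x'}` and the Rees chart of `𝒪_{X',x'}`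
  obtain ⟨n, c, hc⟩ := Submodule.fg_iff_exists_fin_generating_family.mp
    (IsNoetherian.noetherian (maximalIdeal (X.presheaf.stalk (π x'))))
  have hc' : Ideal.span (Set.range c) = stalkIdeal Z (π x') := by rw [hZ]; exact hc
  obtain ⟨j, 𝔴, χ, hχ, hloc, -⟩ := hπ.exists_reesChart_stalk x' c hc'
  letI := χ.toAlgebra
  haveI : IsLocalization.AtPrime (X'.presheaf.stalk x') 𝔴.asIdeal := hloc
  have hχa : (algebraMap (chartRing c j) (X'.presheaf.stalk x') : _ →+* _) = χ :=
    RingHom.algebraMap_toAlgebra χ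
  have hσ : ∀ a, (π.stalkMap x').hom a =
      (algebraMap (chartRing c j) (X'.presheaf.stalk x') : chartRing c j →+* _) (chartBase c j a) := by
    intro a
    rw [hχa]
    exact (hχ a).symm
  -- the exceptional stalk `(Z·𝒪_{X'})_{x'} = (σ c_j)`
  have hE : stalkIdeal (Z.comap π) x' = Ideal.span {(π.stalkMap x').hom (c j)} := by
    rw [stalkIdeal_comap_eq_map_stalkMap, ← hc', Ideal.map_span]
    apply le_antisymm
    · rw [Ideal.span_le]
      rintro _ ⟨_, ⟨l, rfl⟩, rfl⟩
      have h2 := congrArg χ (reesChartBase_apply_eq_mul_chartGen c j l)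
      simp only [map_mul, hχ] at h2
      rw [SetLike.mem_coe, Ideal.mem_span_singleton']
      exact ⟨χ (chartGen c j l), by rw [mul_comm, h2]⟩
    · exact (Ideal.span_singleton_le_iff_mem _).mpr (Ideal.subset_span ⟨c j, ⟨j, rfl⟩, rfl⟩)
  have hst : stalkIdeal (strictTransformIdeal π Z 𝒦) x' =
      stOp (π.stalkMap x').hom (Ideal.span {(π.stalkMap x').hom (c j)}) (stalkIdeal 𝒦 (π x')) := by
    rw [stalkIdeal_strictTransformIdeal_eq_stOp, hE]
  -- `c_j ∉ 𝔮` (else `1 ∈ 𝔮'`)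
  have hq : c j ∉ stalkIdeal 𝒦 (π x') := by
    intro hcj
    have h1 : (1 : X'.presheaf.stalk x') ∈ stalkIdeal (strictTransformIdeal π Z 𝒦) x' := by
      rw [hst, mem_stOp_iff]
      refine ⟨1, ?_⟩
      rw [pow_one, Ideal.span_singleton_mul_span_singleton, one_mul, Ideal.span_singleton_le_iff_mem]
      exact Ideal.mem_map_of_mem _ hcj
    exact (maximalIdeal.isMaximal _).ne_top (Ideal.eq_top_of_isUnit_mem _ (h𝔮'le h1) isUnit_one)
  have hne' : stOp (π.stalkMap x').hom (Ideal.span {(π.stalkMap x').hom (c j)}) (stalkIdeal 𝒦 (π x')) ≠ ⊤ := by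
    rw [← hst]
    exact ne_top_of_le_ne_top (maximalIdeal.isMaximal _).ne_top h𝔮'le
  rw [hst]
  exact isPrime_stOp_chart c j 𝔴.asIdeal (stalkIdeal 𝒦 (π x')) hq (π.stalkMap x').hom hσ _ rfl hne'

end PointRound

/-! ## §163 (g45 · E2, FOREIGN ROUND) off the centre the stalk map is an isomorphism carrying the germ to its strict transform -/

section ForeignRound

variable {X X' : Scheme.{0}} [IsLocallyNoetherian X] [IsLocallyNoetherian X'] (π : X' ⟶ X) (Z 𝒦 : X.IdealSheafData)

/-- **(E2) foreign round.**  If `π x' ∉ V(Z)` then `π^#_{x'}` is an isomorphism (`IsBlowup.isIso_stalkMap_of_not_mem_support`), the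
strict-transform stalk is `𝔮𝒪'` (`IsBlowup.stalkIdeal_strictTransformIdeal_of_not_mem`): PRIME, contracting to `𝔮`, with ISOMORPHIC
quotients `𝒪/𝔮 ≃ 𝒪'/𝒦'_{x'}`. [folklore; GortzWedhorn2020 (13.19), StacksProject 02OS] -/
theorem isPrime_stalkIdeal_strictTransformIdeal_foreign (hπ : IsBlowup π Z) (x' : X')
    (hx : π x' ∉ (Z.support : Set X)) [h𝔮 : (stalkIdeal 𝒦 (π x')).IsPrime] :
    (stalkIdeal (strictTransformIdeal π Z 𝒦) x').IsPrime ∧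
      (stalkIdeal (strictTransformIdeal π Z 𝒦) x').comap (π.stalkMap x').hom = stalkIdeal 𝒦 (π x') ∧
      Nonempty ((X.presheaf.stalk (π x') ⧸ stalkIdeal 𝒦 (π x')) ≃+*
        (X'.presheaf.stalk x' ⧸ stalkIdeal (strictTransformIdeal π Z 𝒦) x')) := by
  haveI := hπ.isIso_stalkMap_of_not_mem_support hx
  have hbij : Function.Bijective (π.stalkMap x').hom := ConcreteCategory.bijective_of_isIso (π.stalkMap x')
  have h' : stalkIdeal (strictTransformIdeal π Z 𝒦) x' = (stalkIdeal 𝒦 (π x')).map (π.stalkMap x').hom := by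
    rw [hπ.stalkIdeal_strictTransformIdeal_of_not_mem 𝒦 hx, stalkIdeal_comap_eq_map_stalkMap]
  refine ⟨?_, ?_, ⟨Ideal.quotientEquiv _ _ (RingEquiv.ofBijective (π.stalkMap x').hom hbij) ?_⟩⟩
  · rw [h']
    exact Ideal.map_isPrime_of_surjective hbij.2
      (by rw [(RingHom.injective_iff_ker_eq_bot _).mp hbij.1]; exact bot_le)
  · rw [h']
    exact Ideal.comap_map_of_bijective _ hbij
  · rw [h']
    congr 1

end ForeignRound

end Summit.ResolutionOfSingularities.ResolutionOfSingularities.Theorems.HugValuationCut
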